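import Literature.IUT.HodgeArakelov.MonoThetaProjective
import Literature.AnabelianGeometry.SemiGraphs.TemperedAnabelian
import Literature.AnabelianGeometry.AbsoluteAnabelian.AbsTopII.EllipticCuspidalization
import HarnessLib

/-!
# [IUTchII] Prop. 1.6 (ii): the successor predicate pinning the reference surjection `projRef` to the
# ELLIPTIC CUSPIDALISATION of [AbsTopII] Cor. 3.3 (iii) (tempered reading + profinite output of record)

SUCCESSOR file (one `Prop`-valued structure + two plumbing `def`s, statement-only; proofs in the proof-only
companion; no edit of the frozen `MonoThetaProjective.lean` p407497, no new named fact) of the abc-iut cell, wave-5 seat abc-iut-w5-d030 (gen 9), for the DAG node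
**IUTchII:Prop1.6(ii)** (layer L6, OUTSIDE the [IUTchIII] Cor. 3.12 cone). It closes the faithfulness gap recorded
on that node by abc-iut-L6-lead (NODES v3.4ai, §F v1.19ag, on abc-iut-w6-d044's disclosure): "the typed output
does not constrain `projRef` to BE the `N`-torsion elliptic cuspidalisation … needs a successor predicate tying
`projRef` to the elliptic cuspidalization (L6-t1 lineage / L4 AbsTopII:Cor3.3(iii) supplier)"; MERGE-MAP row 141
("ref datum := L4-t6 output").

S. Mochizuki, *Inter-universal Teichmüller Theory II*, kurims manuscript (Dec. 2020), §1, Prop. 1.6 (ii) p. 31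
l. 34–41, read on the page: "(Elliptic Cuspidalizations) Let `N` be a positive integer. Then there exists a
functorial group-theoretic algorithm [cf. [AbsTopII], Corollary 3.3, (iii); [AbsTopII], Remark 3.3.3]
`Π ↦ {Π_{U_N}(Π) ↠ Π}` for constructing from `Π` a topological group `Π_{U_N}(Π)` equipped with a surjection
`Π_{U_N}(Π) ↠ Π` … such that when `Π = Π^tp_{X̲̲_k}`, the surjection `Π_{U_N}(Π) ↠ Π` may be naturally identified
with a certain surjection — i.e., “elliptic cuspidalization” — that arises from a certain open immersion
determined by the `N`-torsion points of a once-punctured elliptic curve that forms a double covering of `C_k`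
[cf. [AbsTopII], Corollary 3.3, (iii)]." [claim: Mochizuki2012, status: disputed] (IUTchII §1 Prop 1.6 (ii),
kurims p.31). S. Mochizuki, *Topics in Absolute Anabelian Geometry II*, Cor. 3.3 (iii) pp. 68–69 (the output
`Π_{U_X} ↠ Π`, (c): "The decomposition groups of the closed points of `X` lying in the complement of `U_X` may
be obtained as the images via `Π_{U_X} ↠ Π` of the cuspidal decomposition groups of `Π_{U_X}`")
[cite: MochizukiAbsTopII2013, Cor 3.3 (iii) p.68]; S. Mochizuki, *Semi-graphs of anabelioids* [SemiAnbd] §6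
pp. 69–74 (tempered fundamental groups of hyperbolic curves over MLF's with their profinite completions, cusps,
decomposition and inertia groups; the category `DLoc`: "a surjection of tempered groups `H ↠ J` where … `J` is
the quotient of `H` by the closed normal subgroup generated by some collection of cuspidal geometric decomposition
groups") [cite: MochizukiSemiAnbd2006, §6 pp.69-74].

## What is typed

The frozen output `EllipticCuspidalization S N P` (fields `PiU ↠ P`, reference datum `PiURef`,
`projRef : PiURef →* S.PiX`, `identified`) leaves `projRef` an unconstrained interface datum ("formally `N` is a
LABEL only", frozen docstring; kernel form `EllipticCuspidalization.nonempty_iff`, p412824). THIS file types the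
printed identification clause as a `Prop`-valued SUCCESSOR PREDICATE on the frozen output, in the vocabulary the
tree already has — abc-iut-L3's `SemiGraphs.TemperedCurve p` (the [SemiAnbd] §6 interface: `Π^temp`, `aug`,
profinite completion `toHat`, closed points `Pt`, cusps, decomposition/inertia groups) and abc-iut-L4-t6's OUTPUT
OF RECORD `AbsTopII.EllipticCuspidalization` of [AbsTopII] Cor. 3.3 (iii) (p405052) — never asserted, to be taken
BY NAME as a binder by consumers and inhabited at genuine models:

* **`EllipticCuspidalization.RefIsElliptic K X U eX eU`** — for tempered curves `X` (playing `X̲̲_k`) and `U`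
  (playing `U_X`, the "certain open immersion determined by the `N`-torsion points") with identifications
  `eX : Π^tp_X ≃ₜ* S.PiX`, `eU : Π^tp_U ≃ₜ* K.PiURef`:
  (R0) "`Π = Π^tp_{X̲̲_k}`" — `eX` carries `Δ^tp_X` onto the setting's `Δ^tp_{X̲̲_k} = Ker(S.aug)`;
  (R1) TEMPERED CUSPIDALISATION ([AbsTopII] Rmk. 3.3.3's "tempered version" of Cor. 3.3, cited by Prop. 1.6 (ii))
  — same base field, `projRef` continuous and over the augmentations, and its kernel
  is the closed normal subgroup of `Π^tp_U` generated by the inertia groups of a set `R` of cusps of `U` (the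
  `DLoc` shape of [SemiAnbd] §6), these REMOVED cusps mapping onto decomposition groups of NON-cuspidal closed
  points of `X` ([AbsTopII] Cor. 3.3 (iii)(c));
  (R2) ELLIPTIC OF LEVEL `N` — the profinite completion of the surjection IS abc-iut-L4-t6's [AbsTopII] Cor. 3.3
  (iii) output: a fundamental extension `E` with `E.arith ≃ₜ* Π̂_X` matching `Δ̂_X`, a record
  `C : AbsTopII.EllipticCuspidalization E` WITH `C.N = N`, and `C.cuspUX.arith ≃ₜ* Π̂_U` making the square
  `Π̂_U → Π̂_X` over `Π^tp_U ↠ Π^tp_X` commute — so the label `N` becomes load-bearing (`RefIsElliptic.exists_level`).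
* `EllipticCuspidalization.transport` — the output's functorial transport along `P ≃ₜ* P'` as DATA (same
  `Π_{U_N}(·)`, same reference datum; the `Nonempty` form is `nonempty_transport`, p412824); `refHom` — the
  reference surjection read on the tempered curves, `eX⁻¹ ∘ projRef ∘ eU`.
* PROOF-ONLY COMPANION `MonoThetaProjectiveProp16EllipticRefProofs.lean` (same seat): `projRef_surjective`,
  `RefIsElliptic.refHom_continuous/…surjective`, `.isClosed_ker`, `.inertia_le_ker`, `.exists_level` (the label `N`
  is load-bearing under the predicate), `.removed_not_cusp_image`, `.transport` (stability under `transport`).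

HONEST SCOPE: a PREDICATE; inhabiting it at the [EtTh] model (`ThetaSetting.ofDoubleUnderline`, whose `PiX` is
abc-iut-L6-t7's `temperedCurveXuu….PiTemp = C.Huu`) needs the tempered fundamental group of the punctured curve
`U_X` and the functoriality of `π₁^temp` for open immersions — [SemiAnbd] §6 INTERFACE data (André), the MERGE debt
of MERGE-MAP rows 92/141, unchanged; the interface-level witness of p412824 (`projRef := id`) is NOT claimed to
satisfy it. Nothing here takes a side on [IUTchIII] Cor. 3.12; typed ≠ proved; constructed ≠ the paper's
reconstruction algorithms.
-/

open Topology
open scoped Pointwise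

universe u

namespace Literature.IUT.HodgeArakelov

open Literature.AnabelianGeometry.SemiGraphs (TemperedCurve)
open Literature.AnabelianGeometry.AbsoluteAnabelian (FundamentalExtension)

namespace EllipticCuspidalization

variable {S : ThetaSetting.{u}} {N : ℕ+} {P P' : TopGroup.{u}}

/-! ## The reference surjection of the frozen output -/

/-- **Functorial transport of the frozen output** along `P ≃ₜ* P'` ("functorial group-theoretic algorithm"):
SAME `Π_{U_N}(·)`, SAME reference datum, the surjection composed with the isomorphism (the data form of
`nonempty_transport`, p412824). [claim: Mochizuki2012, status: disputed] (IUTchII §1 Prop 1.6 (ii), kurims p.31) -/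
noncomputable def transport (K : EllipticCuspidalization S N P) (f : P ≃ₜ* P') : EllipticCuspidalization S N P' where
  isoRef := ⟨f.symm.trans K.isoRef.some⟩
  PiU := K.PiU
  proj := f.toMulEquiv.toMonoidHom.comp K.proj
  proj_continuous := f.continuous.comp K.proj_continuous
  proj_surjective := f.surjective.comp K.proj_surjective
  PiURef := K.PiURef
  projRef := K.projRef
  identified :=
    K.identified.elim fun e he => he.elim fun eU heU =>
      ⟨f.symm.trans e, eU, fun y => (heU y).trans (congrArg e (f.symm_apply_apply (K.proj y)).symm)⟩

/-- The transport keeps the reference datum. [claim: Mochizuki2012, status: disputed] (IUTchII §1 Prop 1.6 (ii), kurims p.31) -/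
theorem transport_PiURef (K : EllipticCuspidalization S N P) (f : P ≃ₜ* P') :
    (K.transport f).PiURef = K.PiURef := rfl

/-- The transport keeps the reference surjection. [claim: Mochizuki2012, status: disputed] (IUTchII §1 Prop 1.6 (ii), kurims p.31) -/
theorem transport_projRef (K : EllipticCuspidalization S N P) (f : P ≃ₜ* P') :
    (K.transport f).projRef = K.projRef := rfl

/-! ## The tempered reading of the reference surjection -/

section Ref

variable {p : ℕ} [Fact p.Prime]

/-- The reference surjection READ ON TEMPERED CURVES: `Π^tp_U → Π^tp_X` obtained from `projRef` through the
identifications `eU : Π^tp_U ≃ₜ* Π^tp_{U_N}` (reference side of the output) and `eX : Π^tp_X ≃ₜ* Π^tp_{X̲̲_k}`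
(the setting's tempered group). [claim: Mochizuki2012, status: disputed] (IUTchII §1 Prop 1.6 (ii), kurims p.31) -/
def refHom (K : EllipticCuspidalization S N P) (X U : TemperedCurve p) (eX : X.PiTemp ≃ₜ* S.PiX)
    (eU : U.PiTemp ≃ₜ* K.PiURef) : U.PiTemp →* X.PiTemp :=
  eX.symm.toMulEquiv.toMonoidHom.comp (K.projRef.comp eU.toMulEquiv.toMonoidHom)

/-- `refHom` unfolds to `eX⁻¹ ∘ projRef ∘ eU`. [claim: Mochizuki2012, status: disputed] (IUTchII §1 Prop 1.6 (ii), kurims p.31) -/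
theorem refHom_apply (K : EllipticCuspidalization S N P) (X U : TemperedCurve p)
    (eX : X.PiTemp ≃ₜ* S.PiX) (eU : U.PiTemp ≃ₜ* K.PiURef) (y : U.PiTemp) :
    K.refHom X U eX eU y = eX.symm (K.projRef (eU y)) := rfl

/-- **THE SUCCESSOR PREDICATE of IUTchII:Prop1.6(ii).** For the frozen output `K` over the setting `S`, tempered
curves `X` ("`Π = Π^tp_{X̲̲_k}`") and `U` ("a certain open immersion determined by the `N`-torsion points of a
once-punctured elliptic curve that forms a double covering of `C_k`") with identifications `eX`, `eU` of their
tempered fundamental groups with `S.PiX` and `K.PiURef`: the reference surjection `projRef` IS the elliptic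
cuspidalisation — (R1) at the tempered [SemiAnbd] §6 interface: a continuous surjection over the augmentations
whose kernel is the closed normal subgroup generated by the inertia groups of the REMOVED cusps `R` of `U`, which map
onto decomposition groups of non-cuspidal points of `X` ([AbsTopII] Cor. 3.3 (iii)(c)); (R2) at the profinite
level: its completion IS abc-iut-L4-t6's [AbsTopII] Cor. 3.3 (iii) output record OF LEVEL `N` — the "tempered
version" of Cor. 3.3 that Prop. 1.6 (ii) cites ("[cf. [AbsTopII], Corollary 3.3, (iii); [AbsTopII], Remark 3.3.3]";
Rmk. 3.3.3 p. 69: "Corollary 3.3 admits a 'tempered version', when the base field `k` is an MLF … We leave the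
routine details to the reader"). A `Prop`; never asserted; to be inhabited at genuine models and consumed BY NAME.
[cite: MochizukiAbsTopII2013, Rmk 3.3.3 p.69]
[claim: Mochizuki2012, status: disputed] (IUTchII §1 Prop 1.6 (ii), kurims p.31) -/
structure RefIsElliptic (K : EllipticCuspidalization S N P) (X U : TemperedCurve p)
    (eX : X.PiTemp ≃ₜ* S.PiX) (eU : U.PiTemp ≃ₜ* K.PiURef) : Prop where
  /-- "`Π = Π^tp_{X̲̲_k}`": the identification `eX` carries `Δ^tp_X = Ker(Π^tp_X → G_k)` onto the setting's
  `Δ^tp_{X̲̲_k} = Ker(S.aug)` (the tempered curve `X` IS the setting's curve, augmentation included) -/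
  deltaTemp_eq : X.DeltaTemp.map eX.toMulEquiv.toMonoidHom = S.DeltaX
  /-- `U_X` and `X̲̲_k` are curves over the same field `k` -/
  K_eq : U.K = X.K
  /-- the reference surjection is continuous (a surjection of TOPOLOGICAL groups) -/
  continuous_projRef : Continuous K.projRef
  /-- … and lies over the augmentations to `G_k ≤ G_{ℚ_p}` -/
  aug_comp : ∀ y : U.PiTemp, X.aug (K.refHom X U eX eU y) = U.aug y
  /-- (R1) + [AbsTopII] Cor. 3.3 (iii)(c): there is a set `R` of REMOVED CUSPS of `U` such that the kernel of
  `Π^tp_U ↠ Π^tp_X` is the closed normal subgroup generated by their inertia groups ([SemiAnbd] §6 `DLoc` shape),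
  and the decomposition group of each removed cusp maps onto a decomposition group of a NON-cuspidal closed point
  of `X` (an `N`-torsion point) -/
  kernel_eq : ∃ R : Set U.Pt, (∀ x ∈ R, U.IsCusp x) ∧
    (K.refHom X U eX eU).ker =
      (Subgroup.normalClosure (⋃ x ∈ R, (U.inertia x : Set U.PiTemp))).topologicalClosure ∧
    ∀ x ∈ R, ∃ y : X.Pt, ¬ X.IsCusp y ∧
      ∃ γ : ConjAct X.PiTemp, (U.decomp x).map (K.refHom X U eX eU) = γ • X.decomp y
  /-- (R2) ELLIPTIC OF LEVEL `N`: the profinite completion of `Π^tp_U ↠ Π^tp_X` IS the [AbsTopII] Cor. 3.3 (iii)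
  output `Π_{U_X} ↠ Π` of abc-iut-L4-t6's record, WITH `C.N = N` — an extension `E` identified with `Π̂_X`
  (matching `Δ̂_X`), a record `C` over it, and `Π̂_U ≃ C.cuspUX.arith` making the completion square commute -/
  elliptic : ∃ (E : FundamentalExtension.{0}) (iX : X.PiHat ≃ₜ* E.arith)
      (C : Literature.AnabelianGeometry.AbsoluteAnabelian.AbsTopII.EllipticCuspidalization E)
      (iU : U.PiHat ≃ₜ* C.cuspUX.arith),
    C.N = (N : ℕ) ∧ (∀ z : X.PiHat, iX z ∈ E.geom ↔ z ∈ X.DeltaHat) ∧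
      ∀ y : U.PiTemp, C.proj.arith (iU (U.toHat y)) = iX (X.toHat (K.refHom X U eX eU y))


end Ref

end EllipticCuspidalization

end Literature.IUT.HodgeArakelov
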